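import Mathlib.Algebra.MvPolynomial.Equiv
import Mathlib.Algebra.MvPolynomial.Funext
import Mathlib.Algebra.Polynomial.Roots
import Mathlib.Topology.Algebra.MvPolynomial
import Mathlib.Topology.Baire.Lemmas
import Mathlib.Topology.Baire.CompleteMetrizable
import Mathlib.Analysis.Complex.Basic
import Mathlib.Data.Finsupp.Encodable
import HarnessLib

/-!
# Generic complex points: polynomials vanishing on open sets, density of algebraically generic points

`Literature/NumberTheory/Transcendental/NesterenkoGenericPoints.lean`. Analytic toolkit for the
specialisation route to LNM 1752 Ch. 3 Prop. 4.11 (Nesterenko–Philippon (eds.), LNM 1752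
(2001)): the identities of the `u`-resultant (`NesterenkoUResultantSpecialize.lean`,
`exists_split_complexSpec`) are available at complex points `z ∈ ℂ^N` at which the evaluation
`ℚ[u] → ℂ`, `u ↦ z`, is injective ("generic points"); inequalities proved there extend to all
points by density and continuity. This file proves, for a finite index type `ι`:

* `MvPolynomial.eq_zero_of_eval_eq_zero_of_isOpen` — a complex polynomial vanishing on a non-empty
  open subset of `ι → ℂ` is zero (induction on the number of variables, a univariate polynomial
  with infinitely many roots is zero);
* `dense_setOf_injective_aeval` — **the generic points are dense**: the set of `z : ι → ℂ` with
  `aeval z : ℚ[u] → ℂ` injective is dense (Baire: it is the countable intersection, over the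
  non-zero `P ∈ ℚ[u]`, of the open dense sets `{P(z) ≠ 0}`); in particular non-empty
  (`exists_injective_aeval`);
* `le_of_forall_generic` — a closed condition `f z ≤ g z` (`f, g` continuous) that holds at all
  generic points holds everywhere.

Everything is proved; folklore, nothing is cited beyond the use it serves.

## References

* [NesterenkoPhilippon2001] Yu. V. Nesterenko, P. Philippon (eds.), *Introduction to Algebraic
  Independence Theory*, LNM 1752, Springer 2001, Ch. 3 §4, Prop. 4.11 (pp. 40–41).
-/

noncomputable section

open MvPolynomial Metric

namespace Literature.NumberTheory.Transcendental

namespace Nesterenko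

/-! ### A polynomial vanishing on an open set vanishes -/

/-- A ball of `ℂ` of positive radius is infinite. [folklore] -/
theorem ball_infinite (y₀ : ℂ) {ε : ℝ} (hε : 0 < ε) : (ball y₀ ε).Infinite := by
  have hI : (Set.Ioo (0 : ℝ) ε).Infinite := Set.Ioo_infinite hε
  haveI := hI.to_subtype
  refine Set.infinite_of_injective_forall_mem
    (f := fun t : Set.Ioo (0 : ℝ) ε => y₀ + ((t : ℝ) : ℂ)) (fun a b h => ?_) (fun t => ?_)
  · exact Subtype.ext (by exact_mod_cast add_left_cancel h)
  · rw [mem_ball, dist_eq_norm, add_sub_cancel_left, Complex.norm_real, Real.norm_eq_abs,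
      abs_of_pos t.2.1]
    exact t.2.2

/-- **A complex polynomial in `n` variables vanishing on a non-empty open set is zero.**
[folklore] -/
theorem eq_zero_of_eval_eq_zero_of_isOpen_fin : ∀ (n : ℕ) (P : MvPolynomial (Fin n) ℂ)
    (U : Set (Fin n → ℂ)), IsOpen U → U.Nonempty → (∀ z ∈ U, eval z P = 0) → P = 0 := by
  intro n
  induction n with
  | zero =>
    intro P U _ hU hP
    obtain ⟨z, hz⟩ := hU
    have h := hP z hz
    rw [eq_C_of_isEmpty P, eval_C] at h
    rw [eq_C_of_isEmpty P, h, C_0]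
  | succ n ih =>
    intro P U hUo hU hP
    obtain ⟨z₀, hz₀⟩ := hU
    obtain ⟨ε, hε, hball⟩ := Metric.isOpen_iff.mp hUo z₀ hz₀
    -- `P(cons y x) = 0` for `y` near `z₀ 0` and `x` near `tail z₀`
    have hcons : ∀ x ∈ ball (Fin.tail z₀) ε, ∀ y ∈ ball (z₀ 0) ε,
        eval (Fin.cons y x : Fin (n + 1) → ℂ) P = 0 := by
      intro x hx y hy
      refine hP _ (hball ?_)
      rw [mem_ball, dist_pi_lt_iff hε]
      intro i
      induction i using Fin.cases with
      | zero => simpa using hy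
      | succ j =>
        simp only [Fin.cons_succ]
        exact (dist_le_pi_dist x (Fin.tail z₀) j).trans_lt hx
    -- for such `x` the univariate polynomial `P(·, x)` vanishes identically
    have hunivar : ∀ x ∈ ball (Fin.tail z₀) ε,
        Polynomial.map (eval x) (finSuccEquiv ℂ n P) = 0 := by
      intro x hx
      refine Polynomial.eq_zero_of_infinite_isRoot _ ((ball_infinite (z₀ 0) hε).mono ?_)
      intro y hy
      rw [Set.mem_setOf_eq, Polynomial.IsRoot.def, ← eval_eq_eval_mv_eval']
      exact hcons x hx y hy
    -- hence all its coefficients, polynomials in `n` variables, vanish near `tail z₀`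
    have hcoeff : ∀ k, (finSuccEquiv ℂ n P).coeff k = 0 := by
      intro k
      refine ih _ (ball (Fin.tail z₀) ε) isOpen_ball ⟨_, mem_ball_self hε⟩ fun x hx => ?_
      have h := congrArg (fun q => Polynomial.coeff q k) (hunivar x hx)
      simpa [Polynomial.coeff_map] using h
    have h0 : finSuccEquiv ℂ n P = 0 := Polynomial.ext fun k => by rw [hcoeff k]; rfl
    exact (finSuccEquiv ℂ n).injective (by rw [h0, map_zero])

/-- **A complex polynomial in finitely many variables vanishing on a non-empty open set is zero.**
[folklore] -/
theorem eq_zero_of_eval_eq_zero_of_isOpen {ι : Type*} [Fintype ι] (P : MvPolynomial ι ℂ)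
    {U : Set (ι → ℂ)} (hUo : IsOpen U) (hU : U.Nonempty) (hP : ∀ z ∈ U, eval z P = 0) : P = 0 := by
  classical
  set e := Fintype.equivFin ι with he
  -- transport to `Fin n`
  set P' := rename e P with hP'
  set U' : Set (Fin (Fintype.card ι) → ℂ) := (fun z' => z' ∘ e) ⁻¹' U with hU'
  have hcont : Continuous fun z' : Fin (Fintype.card ι) → ℂ => z' ∘ e :=
    continuous_pi fun i => continuous_apply (e i)
  have hU'o : IsOpen U' := hUo.preimage hcont
  have hU'ne : U'.Nonempty := by
    obtain ⟨z, hz⟩ := hU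
    refine ⟨z ∘ e.symm, ?_⟩
    change (z ∘ e.symm) ∘ e ∈ U
    have : (z ∘ ⇑e.symm) ∘ ⇑e = z := by funext i; simp
    rwa [this]
  have hP'0 : P' = 0 := eq_zero_of_eval_eq_zero_of_isOpen_fin _ P' U' hU'o hU'ne fun z' hz' => by
    rw [hP', eval_rename]
    exact hP _ hz'
  exact rename_injective e e.injective (by rw [← hP', hP'0, map_zero])

/-! ### Generic points are dense -/

/-- `ℚ[u]` is countable. [folklore] -/
theorem countable_mvPolynomial_rat (ι : Type*) [Countable ι] : Countable (MvPolynomial ι ℚ) :=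
  Function.Injective.countable
    (f := (AddMonoidAlgebra.coeff : MvPolynomial ι ℚ → (ι →₀ ℕ) →₀ ℚ)) AddMonoidAlgebra.coeff_injective

/-- Evaluation of a rational polynomial at a complex point is evaluation of its image.
[folklore] -/
theorem aeval_eq_eval_map {ι : Type*} (z : ι → ℂ) (P : MvPolynomial ι ℚ) :
    aeval z P = eval z (map (algebraMap ℚ ℂ) P) := by
  rw [eval_map, aeval_def]

/-- `z ↦ P(z)` is continuous. [folklore] -/
theorem continuous_aeval {ι : Type*} [Fintype ι] (P : MvPolynomial ι ℚ) :
    Continuous fun z : ι → ℂ => aeval z P := by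
  simp_rw [aeval_eq_eval_map]
  exact MvPolynomial.continuous_eval _

/-- For `P ≠ 0` the set `{z : P(z) ≠ 0}` is open and dense. [folklore] -/
theorem isOpen_dense_setOf_aeval_ne_zero {ι : Type*} [Fintype ι] {P : MvPolynomial ι ℚ}
    (hP : P ≠ 0) : IsOpen {z : ι → ℂ | aeval z P ≠ 0} ∧ Dense {z : ι → ℂ | aeval z P ≠ 0} := by
  have hopen : IsOpen {z : ι → ℂ | aeval z P ≠ 0} :=
    isOpen_ne_fun (continuous_aeval P) continuous_const
  refine ⟨hopen, ?_⟩
  have hcompl : {z : ι → ℂ | aeval z P ≠ 0} = {z : ι → ℂ | aeval z P = 0}ᶜ := by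
    ext z; simp
  rw [hcompl, ← interior_eq_empty_iff_dense_compl]
  by_contra hne
  have hne' : (interior {z : ι → ℂ | aeval z P = 0}).Nonempty := Set.nonempty_iff_ne_empty.mpr hne
  have hmap : map (algebraMap ℚ ℂ) P = 0 :=
    eq_zero_of_eval_eq_zero_of_isOpen _ isOpen_interior hne' fun z hz => by
      rw [← aeval_eq_eval_map]
      have hz' : z ∈ {z : ι → ℂ | aeval z P = 0} := interior_subset hz
      exact hz' 
  exact hP (map_injective _ (algebraMap ℚ ℂ).injective (by rw [hmap, map_zero]))

/-- A point is generic iff no non-zero rational polynomial vanishes at it. [folklore] -/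
theorem injective_aeval_iff {ι : Type*} (z : ι → ℂ) :
    Function.Injective (aeval z : MvPolynomial ι ℚ →ₐ[ℚ] ℂ) ↔
      ∀ P : MvPolynomial ι ℚ, P ≠ 0 → aeval z P ≠ 0 := by
  rw [injective_iff_map_eq_zero]
  exact ⟨fun h P hP h0 => hP (h P h0), fun h P h0 => by_contra fun hP => h P hP h0⟩

/-- **The generic points are dense in `ℂ^ι`** (Baire). [folklore] -/
theorem dense_setOf_injective_aeval (ι : Type*) [Fintype ι] :
    Dense {z : ι → ℂ | Function.Injective (aeval z : MvPolynomial ι ℚ →ₐ[ℚ] ℂ)} := by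
  haveI : Countable (MvPolynomial ι ℚ) := countable_mvPolynomial_rat ι
  have h := dense_iInter_of_isOpen (X := ι → ℂ)
    (f := fun P : {P : MvPolynomial ι ℚ // P ≠ 0} => {z : ι → ℂ | aeval z P.1 ≠ 0})
    (fun P => (isOpen_dense_setOf_aeval_ne_zero P.2).1) (fun P => (isOpen_dense_setOf_aeval_ne_zero P.2).2)
  refine h.mono fun z hz => ?_
  rw [Set.mem_iInter] at hz
  exact (injective_aeval_iff z).mpr fun P hP => hz ⟨P, hP⟩

/-- In particular generic points exist. [folklore] -/
theorem exists_injective_aeval (ι : Type*) [Fintype ι] :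
    ∃ z : ι → ℂ, Function.Injective (aeval z : MvPolynomial ι ℚ →ₐ[ℚ] ℂ) :=
  (dense_setOf_injective_aeval ι).nonempty

/-- **Closed conditions pass from generic points to all points**: if `f, g` are continuous on
`ℂ^ι` and `f z ≤ g z` at every generic `z`, then `f ≤ g` everywhere. [folklore] -/
theorem le_of_forall_generic {ι : Type*} [Fintype ι] {f g : (ι → ℂ) → ℝ} (hf : Continuous f)
    (hg : Continuous g)
    (h : ∀ z : ι → ℂ, Function.Injective (aeval z : MvPolynomial ι ℚ →ₐ[ℚ] ℂ) → f z ≤ g z)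
    (z : ι → ℂ) : f z ≤ g z := by
  have hclosed : IsClosed {z : ι → ℂ | f z ≤ g z} := isClosed_le hf hg
  have hsub : {z : ι → ℂ | Function.Injective (aeval z : MvPolynomial ι ℚ →ₐ[ℚ] ℂ)} ⊆
      {z | f z ≤ g z} := fun z hz => h z hz
  have huniv : Set.univ ⊆ {z : ι → ℂ | f z ≤ g z} := by
    rw [← (dense_setOf_injective_aeval ι).closure_eq]
    exact hclosed.closure_subset_iff.mpr hsub
  exact huniv (Set.mem_univ z)

end Nesterenko

end Literature.NumberTheory.Transcendental

end
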